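/-
Copyright (c) 2026. All rights reserved.
Released under Apache 2.0 license as described in the file LICENSE.
Authors: abc-iut cell, seat abc-iut-w5-d226 (gen 2; the `T = TM` twin of abc-iut-L4-t10's row C45-M0
of plan/L4/SUBDAG-AbsTopIII-Cor45.md — [AbsTopIII] Cor 4.5 at the model for `𝒳 := 𝒞^hol_TM`).
-/
import Literature.AnabelianGeometry.AbsoluteAnabelian.ArchimedeanHolPairsRigidityProofs
import Literature.AnabelianGeometry.AbsoluteAnabelian.AbsTopIII.AutHolLogFrobeniusModelProofs
import HarnessLib

/-!
# [AbsTopIII] Corollary 4.5 at the model for `T = TM` (`𝒳 := 𝒞^hol_TM`)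

S. Mochizuki, *Topics in absolute anabelian geometry III*, Cor 4.5 pp. 107–110 (with Def 4.1 (iv) p. 104,
Prop 4.2 (ii) pp. 105–106) of the author's kurims manuscript (lit key `paper:url-5493eb38cbb7`, read on
the page; bib key `MochizukiAbsTopIII2015`).  Cor 4.5 is stated for "`𝒳 := 𝒞^hol_T = 𝒞̲^hol_T`; `ℰ := EA`;
`𝒩 := 𝒞^hol_TH` — where `T ∈ {TM, TF}`".  abc-iut-L4-t10's `archLogFrobeniusData 𝔄` /
`AbsTopIII.cor_4_5_arch` (`ArchimedeanLogFrobeniusModel.lean`, `AutHolLogFrobeniusModelProofs.lean`)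
is the case `T = TF`; this file is the case **`T = TM`** over the same interface `𝔄 : AutHolFieldFunctor`
(Cor 2.7 (e) + functoriality), with `𝒳 = 𝒞^hol_TM = HolMonoidPair 𝔄 .TM` (abc-iut-w5-d226).

The input data (`archLogFrobeniusDataTM`): first row `= 𝒳 = 𝒞^hol_TM` with `id_⋎ = 𝟭`;
`log := 𝔩𝔬𝔤_{TM,TM}` with `logIsoId :=` Prop 4.2 (ii)'s `𝔩𝔬𝔤_{TM,TM} ≅ 𝟭` (`HolMonoidPair.logTMIsoId`);
`λ^× := 𝔩𝔬𝔤_{TM,TF} ⋙ λ^×`, `λ^∼ := 𝔩𝔬𝔤_{TM,TF} ⋙ λ^∼` — Def 4.1 (iv) defines `λ^×`, `λ^∼` on `𝒞^hol_TF`; a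
`TM`-pair is first carried to `𝒞^hol_TF` by the route `𝒞^hol_TM → EA →^{κ_LH} LinHol →^{φ_LH} 𝒞^hol_TF` of
Prop 4.2 (ii) ("the equivalence `κ_LH` … — i.e., the functorial algorithms of Corollary 2.7 — determines
…"), i.e. `(𝕏 ↶ 𝒪^⊳_k) ↦ (𝕏 ↶ 𝒜_𝕏^×)`, `(𝕏 ↶ 𝒜_𝕏~)` —; `ι_log`, `ι_×` the corresponding whiskerings of
abc-iut-L4-t10's `iotaLog`, `iotaTimes` (`ι_×` in the RIGHT summand, Rmk 4.5.2); `ℰ = EA`, `𝒩 = 𝒞^hol_TH`,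
`𝒜 = LinHol`, `κ_LH`; `φ := φ_LH ⋙ (𝒞^hol_TF → 𝒞^hol_TM)` (Def 4.1 (iii) natural functor) and `η` the
tautological isomorphism; telecore data `⟨φ, unitor, η⟩` (`archTelecoreDataTM`).

RESULT `AbsTopIII.cor_4_5_arch_TM 𝔄 X₀ hE : Cor_4_5 (archLogFrobeniusDataTM 𝔄) (archTelecoreDataTM 𝔄)` — all
five items of the typed Cor 4.5 for the `TM` model from an object `X₀` of `EA` and `IsIdRigid EA` ONLY
(abc-iut-w5-d210's `cor_4_5_of_inputs_of_isEquivalence`): orientation `rfl`; coherence of the telecore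
data by construction; (M3) the Lemma-4.4 property REDUCED to abc-iut-L4-t10's `arch_lemma44Property`
(the composite `λ^×(a) ≫ ι_log ≫ ι_×` at `(𝕏 ↶ 𝒪^⊳_k)` IS the `T = TF` composite at `(𝕏 ↶ 𝒜_𝕏)` along the
finite étale `a_𝕏`); (M4) `IsIdRigid 𝒞^hol_TM ⟸ IsIdRigid EA` (abc-iut-w5-d226's
`HolMonoidPair.isIdRigid_of_isIdRigid_EA`, Prop 4.2 (i)).  Variant from `IsSlim EA` (abc-iut-w5-d215);
non-vacuity of the two binders at the one-object interface (`cor_4_5_arch_TM_hypotheses_satisfiable`).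

Refereed pre-IUT anabelian geometry; a MODEL over a named interface — the geometric instance of `𝔄`
(Cor 2.7) and `IsIdRigid EA` (Lem 4.3 + Cor 2.3 (i)) are NOT asserted; nothing here bears on
[IUTchIII] Cor. 3.12 or takes a side; typed ≠ discharged except for the theorems of this file.
-/

set_option autoImplicit false

noncomputable section

namespace Literature.AnabelianGeometry.AbsoluteAnabelian

open _root_.CategoryTheory

universe u

namespace HolMonoidPair

variable (𝔄 : AutHolFieldFunctor.{u})

/-- **`λ^×` on `𝒞^hol_TM`** at the model: `(𝕏 ↶ 𝒪^⊳_k) ↦ λ^×(𝕏 ↶ 𝒜_𝕏) = (𝕏 ↶ 𝒜_𝕏^×)` (Def 4.1 (iv)'s `λ^×`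
after the `κ_LH`-route `𝔩𝔬𝔤_{TM,TF}` of Prop 4.2 (ii)). [cite: MochizukiAbsTopIII2015, Corollary 4.5 p.107] -/
def lamTimesTM : HolMonoidPair 𝔄 .TM ⥤ HolTHPair 𝔄 := logTMTF 𝔄 ⋙ HolTFPair.lamTimes 𝔄

/-- **`λ^∼` on `𝒞^hol_TM`** at the model: `(𝕏 ↶ 𝒪^⊳_k) ↦ λ^∼(𝕏 ↶ 𝒜_𝕏) = (𝕏 ↶ 𝒜_𝕏~)`.
[cite: MochizukiAbsTopIII2015, Corollary 4.5 p.107] -/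
def lamSimTM : HolMonoidPair 𝔄 .TM ⥤ HolTHPair 𝔄 := logTMTF 𝔄 ⋙ HolTFPair.lamSim 𝔄

/-- `𝔩𝔬𝔤_{TM,TF}` after `𝔩𝔬𝔤_{TM,TM}` is `𝔩𝔬𝔤_{TM,TF}` on objects (both give `(𝕏 ↶ 𝒜_𝕏)`).
[cite: MochizukiAbsTopIII2015, Proposition 4.2 (ii) p.105] -/
theorem logTMTF_obj_logTM_obj (P : HolMonoidPair 𝔄 .TM) :
    (logTMTF 𝔄).obj ((logTM 𝔄 ArchPairType.isMonoidType_TM).obj P) = (logTMTF 𝔄).obj P := rfl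

/-- **`ι_log` on `𝒞^hol_TM`**: at `(𝕏 ↶ 𝒪^⊳_k)` the component of abc-iut-L4-t10's `ι_log` at `(𝕏 ↶ 𝒜_𝕏)` — "the
natural inclusion `(k~)^× ↪ k~`" for `k = 𝒜_𝕏` —, in the shape `(log ⋙ id_⋎) ⋙ λ^× ⟶ id_⋎ ⋙ λ^∼` of
`LogFrobeniusData`. [cite: MochizukiAbsTopIII2015, Definition 4.1 (iv) p.104] -/
def iotaLogTM :
    (logTM 𝔄 ArchPairType.isMonoidType_TM ⋙ 𝟭 (HolMonoidPair 𝔄 .TM)) ⋙ lamTimesTM 𝔄 ⟶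
      𝟭 (HolMonoidPair 𝔄 .TM) ⋙ lamSimTM 𝔄 where
  app P := (HolTFPair.iotaLog 𝔄).app ((logTMTF 𝔄).obj P)
  naturality P Q φ := by
    apply HolTHPair.Hom.ext
    · change φ.base ≫ 𝟙 Q.X = 𝟙 P.X ≫ φ.base
      rw [Category.comp_id, Category.id_comp]
    · rfl

/-- **`ι_×` on `𝒞^hol_TM`**: abc-iut-L4-t10's `ι_× : λ^∼ → λ^×` (the universal covering `exp_k`) whiskered
along `𝔩𝔬𝔤_{TM,TF}`. [cite: MochizukiAbsTopIII2015, Definition 4.1 (iv) p.104] -/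
def iotaTimesTM : lamSimTM 𝔄 ⟶ lamTimesTM 𝔄 :=
  Functor.whiskerLeft (logTMTF 𝔄) (HolTFPair.iotaTimes 𝔄)

/-- `φ := φ_LH ⋙ (𝒞^hol_TF → 𝒞^hol_TM)`: `(𝕏, 𝕏 ↶ 𝒜_𝕏) ↦ (𝕏 ↶ 𝒪^⊳_{𝒜_𝕏})` (Cor 4.5 (ii)'s forgetful functor
followed by the natural functor of Def 4.1 (iii)). [cite: MochizukiAbsTopIII2015, Corollary 4.5 (ii) p.108] -/
def φLHTM : LinHol 𝔄 ⥤ HolMonoidPair 𝔄 .TM :=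
  LinHol.φLH 𝔄 ⋙ ofTF 𝔄 ArchPairType.isMonoidType_TM

/-- `φ` for `T = TM` is an equivalence (composite of `φ_LH` and the equivalence `𝒞^hol_TF → 𝒞^hol_TM`).
[cite: MochizukiAbsTopIII2015, Corollary 4.5 (ii) p.108] -/
theorem φLHTM_isEquivalence : (φLHTM 𝔄).IsEquivalence := by
  haveI := LinHol.φLH_isEquivalence 𝔄
  haveI := ofTF_isEquivalence (𝔄 := 𝔄) ArchPairType.isMonoidType_TM
  unfold φLHTM
  infer_instance

/-- `η` for `T = TM`: `((𝒳 → EA) ⋙ κ_LH) ⋙ φ ≅ 𝟭_𝒳`, componentwise the tautological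
`(𝕏 ↶ 𝒪^⊳_{𝒜_𝕏}) ⥲ (𝕏 ↶ 𝒪^⊳_k)` (`etaIso`). [cite: MochizukiAbsTopIII2015, Corollary 4.5 (ii) p.108] -/
def ηLHTM : (toEA 𝔄 .TM ⋙ LinHol.κLH 𝔄) ⋙ φLHTM 𝔄 ≅ 𝟭 (HolMonoidPair 𝔄 .TM) :=
  NatIso.ofComponents (fun P => etaIso P) (fun {P Q} φ => by
    apply Hom.ext_of_base
    change φ.base ≫ 𝟙 Q.X = 𝟙 P.X ≫ φ.base
    rw [Category.comp_id, Category.id_comp])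

end HolMonoidPair

variable (𝔄 : AutHolFieldFunctor.{u})

/-- **The archimedean input data of Cor 4.5 for `T = TM`** as a `LogFrobeniusData`: "`𝒳 := 𝒞^hol_TM`, `ℰ := EA`,
`𝒩 := 𝒞^hol_TH`", first row `= 𝒳` with `id_⋎ = 𝟭`, `log = 𝔩𝔬𝔤_{TM,TM}` with Prop 4.2 (ii)'s `𝔩𝔬𝔤_{TM,TM} ≅ 𝟭`,
`λ^×`, `λ^∼`, `ι_log` and `ι_×` (right summand) through `𝔩𝔬𝔤_{TM,TF}`, the projections to `EA`, `κ_LH` with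
quasi-inverse the projection, `φ = φ_LH ⋙ (𝒞^hol_TF → 𝒞^hol_TM)`, `η`.
[cite: MochizukiAbsTopIII2015, Corollary 4.5 pp.107–108] -/
def archLogFrobeniusDataTM : LogFrobeniusData.{u + 1} where
  X₁ := HolMonoidPair 𝔄 .TM
  X := HolMonoidPair 𝔄 .TM
  toNexus := 𝟭 _
  N := HolTHPair 𝔄
  E := 𝔄.EA
  A := LinHol 𝔄
  log := HolMonoidPair.logTM 𝔄 ArchPairType.isMonoidType_TM
  logIsoId := HolMonoidPair.logTMIsoId 𝔄
  lamTimes := HolMonoidPair.lamTimesTM 𝔄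
  lamPf := HolMonoidPair.lamSimTM 𝔄
  ιlog := HolMonoidPair.iotaLogTM 𝔄
  ιtimes := Sum.inr (HolMonoidPair.iotaTimesTM 𝔄)
  XtoE := HolMonoidPair.toEA 𝔄 .TM
  NtoE := HolTHPair.toEA 𝔄
  lamTimes_NtoE := rfl
  lamPf_NtoE := rfl
  κ := LinHol.κLH 𝔄
  AtoE := LinHol.proj 𝔄
  κ_equiv := LinHol.κLH_isEquivalence 𝔄
  κ_inv := LinHol.κLH_inv 𝔄
  φ := HolMonoidPair.φLHTM 𝔄
  φ_equiv := HolMonoidPair.φLHTM_isEquivalence 𝔄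
  η := HolMonoidPair.ηLHTM 𝔄

/-- The `TM` data is of Aut-holomorphic type: `ι_×` is the right summand.
[cite: MochizukiAbsTopIII2015, Remark 4.5.2 p.111] -/
theorem archLogFrobeniusDataTM_ιtimes :
    (archLogFrobeniusDataTM 𝔄).ιtimes = Sum.inr (HolMonoidPair.iotaTimesTM 𝔄) := rfl

/-- **The first-row telecore data of Cor 4.5 (ii) for `T = TM`**, `⟨φ, unitor, η⟩`.
[cite: MochizukiAbsTopIII2015, Corollary 4.5 (ii) p.108] -/
def archTelecoreDataTM : (archLogFrobeniusDataTM 𝔄).TelecoreData where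
  φ₁ := HolMonoidPair.φLHTM 𝔄
  e := (HolMonoidPair.φLHTM 𝔄).rightUnitor
  η₁ := NatIso.ofComponents (fun P => HolMonoidPair.etaIso P) (fun {P Q} φ => by
    apply HolMonoidPair.Hom.ext_of_base
    change HolMonoidPair.Hom.base φ ≫ 𝟙 (HolTFPair.X Q.toHolTFPair) =
      𝟙 (HolTFPair.X P.toHolTFPair) ≫ HolMonoidPair.Hom.base φ
    rw [Category.comp_id, Category.id_comp])

namespace AbsTopIII

/-- (M1) The `TM` model is of Aut-holomorphic type. [cite: MochizukiAbsTopIII2015, Remark 4.5.2 p.111] -/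
theorem archTM_isAutHolDirection : IsAutHolDirection (archLogFrobeniusDataTM 𝔄) :=
  ⟨HolMonoidPair.iotaTimesTM 𝔄, rfl⟩

/-- (M3) **Lemma 4.4 supplies the `Lemma44Property` of the `TM` model**, REDUCED to the `TF` model: at
`x = (𝕏 ↶ 𝒪^⊳_k)` and an isomorphism `a : x ⟶ 𝔩𝔬𝔤_{TM,TM}(x)`, the composite `λ^×(a) ≫ ι_log ≫ ι_×` IS
abc-iut-L4-t10's composite at the `TF`-pair `(𝕏 ↶ 𝒜_𝕏)` along the lift of `a_𝕏`, which is not the identity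
(`arch_lemma44Property`: it is `z ↦ exp(𝒜_{a_𝕏} z)` on `𝒜_𝕏^×`, not injective).
[cite: MochizukiAbsTopIII2015, Lemma 4.4 p.107] -/
theorem archTM_lemma44Property :
    Lemma44Property (Δ := archLogFrobeniusDataTM 𝔄) (HolMonoidPair.iotaTimesTM 𝔄) := by
  intro x a ha
  -- re-type `a` as a morphism of `𝒞^hol_TM` (the first row of the `TM` data, `id_⋎ = 𝟭`)
  change (x : HolMonoidPair 𝔄 .TM) ⟶
    (HolMonoidPair.logTM 𝔄 ArchPairType.isMonoidType_TM).obj x at a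
  have ha' : IsIso a := ha
  -- the structure part `a_𝕏` of `a`: a finite étale AUTOMORPHISM of `𝕏` (the structure-orbispace of
  -- `𝔩𝔬𝔤_{TM,TM}(x)` is again `𝕏`)
  let f : HolTFPair.X x.toHolTFPair ⟶ HolTFPair.X x.toHolTFPair :=
    @HolMonoidPair.Hom.base 𝔄 ArchPairType.TM x
      ((HolMonoidPair.logTM 𝔄 ArchPairType.isMonoidType_TM).obj x) a
  have hf : IsIso f :=
    @HolMonoidPair.isIso_base_of_isIso 𝔄 ArchPairType.TM x
      ((HolMonoidPair.logTM 𝔄 ArchPairType.isMonoidType_TM).obj x) a ha'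
  haveI := hf
  -- the `IsIso` instance is supplied as a term: the binder of `arch_lemma44Property` lives in the
  -- category `(archLogFrobeniusData 𝔄).X`, definitionally but not reducibly `𝒞^hol_TF`
  exact arch_lemma44Property 𝔄 ((HolTFPair.ofEA 𝔄).obj (HolTFPair.X x.toHolTFPair))
    ((HolTFPair.ofEA 𝔄).map f) (Functor.map_isIso (HolTFPair.ofEA 𝔄) f)

/-- The telecore data `⟨φ, unitor, η⟩` of the `TM` model is COHERENT (printed-case shape hypothesis of
abc-iut-L4-t5's `cor_4_5_ii_of_coherent`). [cite: MochizukiAbsTopIII2015, Corollary 4.5 (ii) p.108] -/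
theorem archTM_telecore_coherent (x : (archLogFrobeniusDataTM 𝔄).X₁) :
    (archLogFrobeniusDataTM 𝔄).toNexus.map ((archTelecoreDataTM 𝔄).η₁.hom.app x) =
      (archTelecoreDataTM 𝔄).e.hom.app ((archLogFrobeniusDataTM 𝔄).κ.obj
        ((archLogFrobeniusDataTM 𝔄).XtoE.obj ((archLogFrobeniusDataTM 𝔄).toNexus.obj x))) ≫
        (archLogFrobeniusDataTM 𝔄).η.hom.app ((archLogFrobeniusDataTM 𝔄).toNexus.obj x) := by
  change (HolMonoidPair.etaIso x).hom = 𝟙 _ ≫ (HolMonoidPair.etaIso x).hom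
  rw [Category.id_comp]

/-- **[AbsTopIII] Corollary 4.5 (i)–(v) for the archimedean MODEL with `T = TM`** (`𝒳 = 𝒞^hol_TM`), from
exactly two inputs: an object `𝕏₀` of `EA` and the id-rigidity of `EA` (Prop 4.2 (i): the id-rigidity of
`𝒞^hol_TM` follows, abc-iut-w5-d226's `HolMonoidPair.isIdRigid_of_isIdRigid_EA`).  Items (i)–(v) are the
cell's theorems over abstract data (abc-iut-L4-t10 / -t5 / -w4-d095 / -w5-d210), assembled by
`cor_4_5_of_inputs_of_isEquivalence` (`id_⋎ = 𝟭` an equivalence).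
[cite: MochizukiAbsTopIII2015, Corollary 4.5 pp.107–109] -/
theorem cor_4_5_arch_TM (X₀ : 𝔄.EA) (hE : IsIdRigid 𝔄.EA) :
    Literature.AnabelianGeometry.AbsoluteAnabelian.AbsTopIII.Cor_4_5 (archLogFrobeniusDataTM 𝔄)
      (archTelecoreDataTM 𝔄) := by
  haveI : (archLogFrobeniusDataTM 𝔄).toNexus.IsEquivalence := Functor.isEquivalence_refl
  exact cor_4_5_of_inputs_of_isEquivalence (Δ := archLogFrobeniusDataTM 𝔄) (archTelecoreDataTM 𝔄)
    (archTM_telecore_coherent 𝔄) (HolMonoidPair.iotaTimesTM 𝔄) rfl ((LinHol.κLH 𝔄).obj X₀)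
    (archTM_lemma44Property 𝔄)
    (HolMonoidPair.isIdRigid_of_isIdRigid_EA ArchPairType.isMonoidType_TM hE)

/-- The five printed items separately, for the `TM` model. [cite: MochizukiAbsTopIII2015, Corollary 4.5 pp.107–109] -/
theorem cor_4_5_arch_TM_items (X₀ : 𝔄.EA) (hE : IsIdRigid 𝔄.EA) :
    Cor_4_5_i (archLogFrobeniusDataTM 𝔄) ∧
      Cor_4_5_ii (archLogFrobeniusDataTM 𝔄) (archTelecoreDataTM 𝔄) ∧
      Cor_4_5_iii (archLogFrobeniusDataTM 𝔄) ∧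
      Cor_4_5_iv (archLogFrobeniusDataTM 𝔄) (archTelecoreDataTM 𝔄) ∧
      Cor_4_5_v (archLogFrobeniusDataTM 𝔄) :=
  (cor_4_5_iff _ _).mp (cor_4_5_arch_TM 𝔄 X₀ hE)

/-- **Cor 4.5 for the `TM` model from slimness of `EA`** (abc-iut-w5-d215's `isIdRigid_of_isSlim`).
[cite: MochizukiAbsTopIII2015, Proposition 4.2 (i) p.106] -/
theorem cor_4_5_arch_TM_of_isSlim (X₀ : 𝔄.EA)
    (hE : Literature.AlgebraicGeometry.Frobenioids.IsSlim 𝔄.EA) :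
    Literature.AnabelianGeometry.AbsoluteAnabelian.AbsTopIII.Cor_4_5 (archLogFrobeniusDataTM 𝔄)
      (archTelecoreDataTM 𝔄) :=
  cor_4_5_arch_TM 𝔄 X₀ (isIdRigid_of_isSlim hE)

/-- **Non-vacuity of the binders**: at the one-object interface (`𝒜 = ℂ`, induced isomorphisms the
identity) `EA` has an object and is id-rigid, so `Cor_4_5` of the `TM` model holds outright there.  A
consistency witness for the abstract layer only. [cite: MochizukiAbsTopIII2015, Corollary 4.5 pp.107–109] -/
theorem cor_4_5_arch_TM_hypotheses_satisfiable :
    ∃ 𝔄 : AutHolFieldFunctor.{0}, Nonempty 𝔄.EA ∧ IsIdRigid 𝔄.EA ∧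
      Literature.AnabelianGeometry.AbsoluteAnabelian.AbsTopIII.Cor_4_5 (archLogFrobeniusDataTM 𝔄)
        (archTelecoreDataTM 𝔄) := by
  let 𝔄 : AutHolFieldFunctor.{0} :=
    { EA := Discrete PUnit.{2}, A := fun _ => ℂ, isCAF := fun _ => isCAF_complex,
      Amap := fun _ => RingEquiv.refl ℂ, continuous_Amap := fun _ => continuous_id,
      continuous_Amap_symm := fun _ => continuous_id, Amap_id := fun _ => rfl,
      Amap_comp := fun _ _ => rfl }
  have hE : IsIdRigid 𝔄.EA :=
    fun α => Iso.ext (NatTrans.ext (funext fun _ => Subsingleton.elim _ _))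
  exact ⟨𝔄, ⟨⟨PUnit.unit⟩⟩, hE, cor_4_5_arch_TM 𝔄 ⟨PUnit.unit⟩ hE⟩

end AbsTopIII

end Literature.AnabelianGeometry.AbsoluteAnabelian

end
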